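import Literature.MathematicalPhysics.QuantumFieldTheory.Balaban1983to89.B5G183CovDecay

/-!
# `Balaban1983to89.B5G183FreeDecay` — the FREE PART of the (1.83) split: strip regularity on the FINE zone with half-width `r/n` and EXPONENTIAL KERNEL DECAY at unit COARSE scale, uniformly in `n` (cell node X9; classical companion of `B5G183CovSplit` / `B5G183CovDecay`)

T. Bałaban, *Propagators and renormalization transformations for lattice gauge theories. I*, Commun. Math.
Phys. **95**, 17–40 (1984) [`Balaban1984PropagatorsI`, cell paper B5], (1.83)–(1.84) p. 31 [PDF 15], text
p. 32–33 [PDF 16–17].  LOCATIONS only: NOTHING printed in B5 or B4 is a hypothesis, a quotation or a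
`[cite:]`-tagged statement of this file; every declaration is `[folklore]` (the classical decay of the massive free
lattice propagator and its powers), kernel-checked from the imported tree modules.  No `axiom`, no `sorry`.

## What this file does

`B5G183CovSplit` subtracted from the continued (1.83) entry symbol the FREE part
`freeN N = δ_{μν}δ_{ll′}R_N(Δ^ξ_n(p′+2πl))`, `R_N(z) = Σ_{j<N}(z+1)^{−(j+1)}` — the alias-decomposed symbol of
`Σ_{j<N}(−Δ^η + 1)^{−(j+1)}` on the `η = 1/n` lattice in unit COARSE mass units — and `B5G183CovDecay` delivered the
kernel decay of the covariant regular remainder.  The free part cannot go through that `n`-uniform sup-norm route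
(its alias sum `Σ_l |R_N(Δ(p′+2πl))|` grows like `n^{d−2}`); it does not need to: it is a function of the FINE-zone
momentum `q = (p′+2πl)/n ∈ [−π,π]^d` alone, `2π`-periodic in `q` with NO alias sum, and the lineage's contour-shift
machine `B4ContourShift` applies to it on the fine zone with the `n`-DEPENDENT half-width `κ = r(d+1)/n`, which is
exactly unit-scale decay in coarse units:
* §1 `fineSym n q := Δ^ξ_n(n·q)` (`B4Strip.DeltaXi` at the rescaled point); `fineSym_eq`: `= n²Σ_μ(2 − 2cos q_μ)`
  (the `η`-lattice Laplacian symbol in fine-momentum units); `fineSym_fine`: at `q = (p′+2πl)/n` it is the shifted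
  coarse-zone symbol `Δ^ξ_n(p′+2πl)`; `fineSym_tr`: `2π`-periodic in every coordinate (all of `ℂ^d`);
  **`re_fineSym_ge`**: `Re fineSym ≥ −25/256` for `|Im q_μ| ≤ κ`, `n·κ ≤ r(d)` (`B4StripCauchy.re_Sxi_ge` at
  `z = n q_μ`, `|Im z| ≤ r ≤ 1/4`, `d r² ≤ 1/16`); `norm_fineSym_add_one_ge` (`‖fineSym + 1‖ ≥ 231/256`),
  `fineSym_add_one_ne_zero`, `differentiableAt_fineSym` (entire).
* §2 **`freeMult n N q := R_N(fineSym n q)`** (`B5G183CovSplit.resolv`); DICTIONARY `freeN_eq_freeMult`: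
  `freeN n N μ ν l l′ p′ = if μ = ν ∧ l = l′ then freeMult n N ((p′+2πl)/n) else 0`; `freeMult_tr` (unconditional
  `2π`-periodicity); **`norm_freeMult_le`**: `‖freeMult‖ ≤ N/(231/256)^N` on the strip `n·κ ≤ r(d)`, UNIFORM IN `n`;
  `differentiableAt_freeMult`.
* §3 `MF N := N/(231/256)^N`; **`stripRegular_freeMult`**: in dimension `d+1`, for every `n ≥ 1`, `N`, `0 ≤ κ`,
  `n·κ ≤ r(d+1)`: `StripRegular (fun q => freeMult n N q) κ (MF N)` (sides by `B4ContourShift.sides_of_periodic`);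
  `rOf_div_admissible` / `rOf_div_pos` (the canonical half-width `r(d+1)/n`); **`latticeKernel_freeMult_decay`**:
  `‖K(m)‖ ≤ MF N · e^{−(r(d+1)/n)·|m|_∞}` for every `m ∈ ℤ^{d+1}` (FINE-lattice integer coordinates; `= e^{−r(d+1)|ηm|_∞}`,
  unit-scale decay in coarse units, rate and constant independent of `n`); **`torusKernel_freeMult_decay`** (every
  period vector, e.g. the fine torus `P_i = n·L_i`; its constant `periodConst (r(d+1)/n) d` is NOT `n`-uniform — it grows
  like `n^{d+1}` — see HONEST SCOPE (v): `n`-uniformity is asserted for the `ℤ^{d+1}` kernel ONLY).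
* DIMENSION CONVENTION (v1.1 clause): §1–§2 are stated on `Fin d → ℂ` with the admissibility `n·κ ≤ r(d)`; §3 works in
  dimension `d+1` (`Fin (d+1) → ℂ`, the `insertNth` convention of `B4ContourShift.StripRegular`), hence `n·κ ≤ r(d+1)` there —
  the same statements, instantiated at `d+1`.

## HONEST SCOPE

(i) CLASSICAL: this is the exponential decay of (powers of) the unit-mass free lattice propagator, nothing of B5;
recorded only so that the pv15 (1.83) chain `B5G183Strip → B5G183Alias → B5G183AliasSum → B5G183CovSplit →
B5G183CovDecay` has its free companion IN THE TREE rather than in a docstring.  (ii) NORMALISATION: `latticeKernel`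
is `B4ContourShift`'s `(2π)^{−(d+1)}∫_{[−π,π]^{d+1}} f(q)e^{iq·m}dq` in fine-lattice integer coordinates `m`; the
`η^{d}`-factors of the `η`-lattice Fourier inversion, the identification `x = ηm`, and the resummation «`Σ_l` over the
coarse zone of the alias-decomposed `freeN` = integral over the fine zone» that matches it with the free part
subtracted in `B5G183CovSplit` (pointwise dictionary `freeN_eq_freeMult` provided) are the consumer's bookkeeping
(t4-ne2-p2, cell GAPS row G-ne2p2-9 (β)).  (iii) CONSTANTS crude: rate `r(d+1) = 1/(4(d+2))` in coarse units versus
the true unit-mass rate `≈ 1`; only the independence of `n`, `N`-explicitness and period-independence are content.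
(iv) `U = 1`, `a = 1` as in the whole b05/pv15 lineage.  (v) (v1.1, answering XREAD adv1-g58 D-1) the TORUS corollary
`torusKernel_freeMult_decay` is TRUE AS TYPED but its constant `MF N · periodConst (r(d+1)/n) d`, with
`periodConst κ′ d = (2e^{κ′}/(1 − e^{−κ′}))^{d+1}`, `κ′ = r(d+1)/n`, is `≥ (2n/r(d+1))^{d+1}`: it is NOT uniform in `n`;
`n`-UNIFORMITY (rate per coarse unit and constant) holds for the `ℤ^{d+1}` kernel `latticeKernel_freeMult_decay` ONLY.  An
`n`-uniform bound on the fine torus `P_i = n·L_i` needs the periodic image sum performed in COARSE units (period `L_i`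
after `x = ηm`, where the `ℤ^{d+1}` bound decays at unit rate) — consumer's bookkeeping, not done here.  Value = kernel certificate (the free half of the (1.83)
regular/free split of X9), NOT summit progress.  Unit `b2b-balaban-pv15-g10` (PV15 cell lineage, generation 10);
v1.1 = v1 (p189816, cb1d82276903) + DOCSTRING-ONLY clauses (header §3 / DIMENSION CONVENTION / HONEST SCOPE (v) / the torus
corollary's docstring); declarations and proofs byte-identical.
-/

open scoped BigOperators Real
open Finset Complex

namespace Literature.MathematicalPhysics.QuantumFieldTheory.Balaban1983to89.B5G183FreeDecay

open Literature.MathematicalPhysics.QuantumFieldTheory.Balaban1983to89.B4Strip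
open Literature.MathematicalPhysics.QuantumFieldTheory.Balaban1983to89.B4StripCauchy
open Literature.MathematicalPhysics.QuantumFieldTheory.Balaban1983to89.B4ContourShift
open Literature.MathematicalPhysics.QuantumFieldTheory.Balaban1983to89.B4TorusKernel (descendC periodConst)
open Literature.MathematicalPhysics.QuantumFieldTheory.Balaban1983to89.B4TorusKernel.MultiPeriod (torusKernel
  torusSupNorm torusKernel_descend_decay_torusMetric)
open Literature.MathematicalPhysics.QuantumFieldTheory.Balaban1983to89.B5Strip145
open Literature.MathematicalPhysics.QuantumFieldTheory.Balaban1983to89.B5Strip145Analytic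
open Literature.MathematicalPhysics.QuantumFieldTheory.Balaban1983to89.B5Strip145Decay (differentiableAt_insertNth
  tr_insertNth_left insertNth_left_mem)
open Literature.MathematicalPhysics.QuantumFieldTheory.Balaban1983to89.B5G183Strip
open Literature.MathematicalPhysics.QuantumFieldTheory.Balaban1983to89.B5G183CovSplit

variable {d : ℕ}

/-! ## §1. The fine-zone symbol `Δ^ξ_n(n·q) = n²Σ_μ(2 − 2cos q_μ)`: dictionary, periodicity, lower bound, holomorphy -/

section Symbol

variable (n : ℕ) [NeZero n]

/-- the symbol of `−Δ^η` (unit COARSE mass units, `η = 1/n`) at FINE-zone momentum `q ∈ [−π,π]^d`: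
`fineSym n q := Δ^ξ_n(n·q)` (`B4Strip.DeltaXi` at the rescaled point). [folklore] -/
noncomputable def fineSym (q : Fin d → ℂ) : ℂ := DeltaXi n 0 ((n : ℂ) • q)

/-- `S_ξ(n·w) = n²(2 − 2cos w)`. [folklore] -/
theorem Sxi_natMul (w : ℂ) : Sxi n ((n : ℂ) * w) = (n : ℂ) ^ 2 * (2 - 2 * Complex.cos w) := by
  have hn : (n : ℂ) ≠ 0 := Nat.cast_ne_zero.mpr (NeZero.ne n)
  unfold Sxi
  rw [mul_div_cancel_left₀ w hn]

/-- DICTIONARY: `fineSym n q = n² Σ_μ (2 − 2cos q_μ)` — the `η`-lattice Laplacian symbol in fine-momentum units.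
[folklore] -/
theorem fineSym_eq (q : Fin d → ℂ) : fineSym n q = ∑ μ, (n : ℂ) ^ 2 * (2 - 2 * Complex.cos (q μ)) := by
  unfold fineSym DeltaXi
  simp only [Pi.smul_apply, smul_eq_mul, Sxi_natMul, Complex.ofReal_zero, add_zero]

/-- DICTIONARY with the alias decomposition: at `q = (p′ + 2πl)/n` the fine-zone symbol is the shifted coarse-zone
symbol `Δ^ξ_n(p′ + 2πl)` of `B4Strip`. [folklore] -/
theorem fineSym_fine (k : Fin d → Fin n) (p : Fin d → ℂ) :
    fineSym n ((n : ℂ)⁻¹ • shift n k p) = DeltaXi n 0 (shift n k p) := by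
  have hn : (n : ℂ) ≠ 0 := Nat.cast_ne_zero.mpr (NeZero.ne n)
  unfold fineSym
  rw [smul_smul, mul_inv_cancel₀ hn, one_smul]

/-- `2π`-PERIODICITY in every coordinate (on all of `ℂ^d`). [folklore] -/
theorem fineSym_tr (q : Fin d → ℂ) (i : Fin d) : fineSym n (tr q i) = fineSym n q := by
  rw [fineSym_eq, fineSym_eq]
  refine Finset.sum_congr rfl (fun μ _ => ?_)
  rw [tr_def]
  by_cases h : μ = i
  · subst h
    rw [Function.update_self]
    have : Complex.cos (q μ + 2 * Real.pi) = Complex.cos (q μ) := by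
      rw [show (q μ + 2 * (Real.pi : ℂ)) = q μ + 2 * (Real.pi : ℂ) from rfl]
      exact_mod_cast Complex.cos_add_two_pi (q μ)
    rw [this]
  · rw [Function.update_of_ne h]

/-- LOWER BOUND on the strip `|Im q_μ| ≤ κ`, `n·κ ≤ r(d)` (`B4StripCauchy.rOf`): `Re fineSym n q ≥ −25/256`
(from `B4StripCauchy.re_Sxi_ge` at `z = n q_μ`, `|Im z| ≤ r ≤ 1/4`, and `d·r² ≤ 1/16`). [folklore] -/
theorem re_fineSym_ge {κ : ℝ} (hκ : (n : ℝ) * κ ≤ rOf d) {q : Fin d → ℂ} (hq : q ∈ Strip d κ) :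
    -(25 / 256 : ℝ) ≤ (fineSym n q).re := by
  have hn : 1 ≤ n := Nat.one_le_iff_ne_zero.mpr (NeZero.ne n)
  have hnr : (0 : ℝ) < n := by exact_mod_cast hn
  have hr4 := rOf_le d
  have hdr := d_mul_rOf_sq_le d
  have hre : (fineSym n q).re = ∑ ν, (Sxi n ((n : ℂ) * q ν)).re := by
    simp only [fineSym, DeltaXi, Pi.smul_apply, smul_eq_mul, Complex.ofReal_zero, add_zero, Complex.re_sum]
  rw [hre]
  have hlow : ∀ ν, -(25 / 16) * rOf d ^ 2 ≤ (Sxi n ((n : ℂ) * q ν)).re := by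
    intro ν
    have him : ((n : ℂ) * q ν).im = n * (q ν).im := by simp
    have hyq : |(q ν).im| ≤ κ := (hq ν).2
    have hy : |((n : ℂ) * q ν).im| ≤ rOf d := by
      rw [him, abs_mul, abs_of_pos hnr]
      exact (mul_le_mul_of_nonneg_left hyq hnr.le).trans hκ
    have hy1 : |((n : ℂ) * q ν).im| ≤ 1 := hy.trans (by linarith)
    have base := re_Sxi_ge n hn ((n : ℂ) * q ν) hy1
    have hsq : ((n : ℂ) * q ν).im ^ 2 ≤ rOf d ^ 2 := by
      have h1 := (abs_le.mp hy).1
      have h2 := (abs_le.mp hy).2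
      nlinarith
    nlinarith [sq_nonneg (Real.sin (((n : ℂ) * q ν).re / (2 * n))), sq_nonneg (n : ℝ)]
  calc -(25 / 256 : ℝ) ≤ ∑ _ν : Fin d, (-(25 / 16) * rOf d ^ 2) := by
        rw [Finset.sum_const, Finset.card_univ, Fintype.card_fin, nsmul_eq_mul]
        have : (d : ℝ) * (-(25 / 16) * rOf d ^ 2) = -(25 / 16) * ((d : ℝ) * rOf d ^ 2) := by ring
        rw [this]; linarith
    _ ≤ ∑ ν, (Sxi n ((n : ℂ) * q ν)).re := Finset.sum_le_sum (fun ν _ => hlow ν)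

/-- hence `‖fineSym n q + 1‖ ≥ 231/256` on that strip: the unit-mass free `η`-lattice propagator and its powers are
regular there. [folklore] -/
theorem norm_fineSym_add_one_ge {κ : ℝ} (hκ : (n : ℝ) * κ ≤ rOf d) {q : Fin d → ℂ} (hq : q ∈ Strip d κ) :
    (231 / 256 : ℝ) ≤ ‖fineSym n q + 1‖ := by
  have h := re_fineSym_ge n hκ hq
  have hre : (fineSym n q + 1).re = (fineSym n q).re + 1 := by simp
  exact le_trans (by rw [hre]; linarith) (Complex.re_le_norm _)

/-- `fineSym n q + 1 ≠ 0` on that strip. [folklore] -/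
theorem fineSym_add_one_ne_zero {κ : ℝ} (hκ : (n : ℝ) * κ ≤ rOf d) {q : Fin d → ℂ} (hq : q ∈ Strip d κ) :
    fineSym n q + 1 ≠ 0 := by
  intro h
  have := norm_fineSym_add_one_ge n hκ hq
  rw [h, norm_zero] at this
  linarith

/-- `fineSym n` is entire. [folklore] -/
theorem differentiableAt_fineSym (q : Fin d → ℂ) : DifferentiableAt ℂ (fun p : Fin d → ℂ => fineSym n p) q := by
  unfold fineSym
  exact (differentiableAt_DeltaXi n 0 ((n : ℂ) • q)).comp q (differentiableAt_id.const_smul (n : ℂ))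

end Symbol

/-! ## §2. The free multiplier `R_N(fineSym)`: periodicity, bound, holomorphy -/

section Mult

variable (n : ℕ) [NeZero n]

/-- THE FREE MULTIPLIER on the fine zone: `freeMult n N q := R_N(Δ^ξ_n(n·q)) = Σ_{j<N} (Δ^ξ_n(n·q) + 1)^{−(j+1)}`
(`B5G183CovSplit.resolv`) — the symbol of `Σ_{j<N}(−Δ^η + 1)^{−(j+1)}`, i.e. of the free part `freeN` subtracted in
`B5G183CovSplit`. [folklore] -/
noncomputable def freeMult (N : ℕ) (q : Fin d → ℂ) : ℂ := resolv N (fineSym n q)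

/-- DICTIONARY: `freeN(l,l′;p′) = δ_{μν}δ_{ll′}·freeMult((p′+2πl)/n)`. [folklore] -/
theorem freeN_eq_freeMult (N : ℕ) (μ ν : Fin d) (k k' : Fin d → Fin n) (p : Fin d → ℂ) :
    freeN n N μ ν k k' p = if μ = ν ∧ k = k' then freeMult n N ((n : ℂ)⁻¹ • shift n k p) else 0 := by
  unfold freeN freeMult
  rw [fineSym_fine]

/-- `2π`-PERIODICITY of the free multiplier in every coordinate (unconditional). [folklore] -/
theorem freeMult_tr (N : ℕ) (q : Fin d → ℂ) (i : Fin d) : freeMult n N (tr q i) = freeMult n N q := by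
  unfold freeMult
  rw [fineSym_tr]

/-- **THE STRIP BOUND** `‖freeMult n N q‖ ≤ N/(231/256)^N` for `|Im q| ≤ κ`, `n·κ ≤ r(d)` — uniform in `n`.
[folklore] -/
theorem norm_freeMult_le {κ : ℝ} (hκ : (n : ℝ) * κ ≤ rOf d) {q : Fin d → ℂ} (hq : q ∈ Strip d κ) (N : ℕ) :
    ‖freeMult n N q‖ ≤ N / (231 / 256 : ℝ) ^ N := by
  unfold freeMult
  exact norm_resolv_le (by norm_num) (by norm_num) (norm_fineSym_add_one_ge n hκ hq) N

/-- **HOLOMORPHY** of the free multiplier at every point of that strip. [folklore] -/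
theorem differentiableAt_freeMult {κ : ℝ} (hκ : (n : ℝ) * κ ≤ rOf d) {q : Fin d → ℂ} (hq : q ∈ Strip d κ)
    (N : ℕ) : DifferentiableAt ℂ (fun p : Fin d → ℂ => freeMult n N p) q := by
  unfold freeMult
  exact differentiableAt_resolv_comp (differentiableAt_fineSym n q) (fineSym_add_one_ne_zero n hκ hq) N

end Mult

/-! ## §3. Strip regularity with half-width `κ ≤ r(d+1)/n` and the kernel decay corollaries -/

section Regular

/-- the explicit `N`-only strip bound. [folklore] -/
noncomputable def MF (N : ℕ) : ℝ := N / (231 / 256 : ℝ) ^ N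

/-- `0 ≤ MF N`. [folklore] -/
theorem MF_nonneg (N : ℕ) : 0 ≤ MF N := by unfold MF; positivity

/-- **STRIP REGULARITY OF THE FREE MULTIPLIER** on `ℂ^{d+1}`: for every `n ≥ 1`, `N`, and `0 ≤ κ` with
`n·κ ≤ r(d+1)`, `freeMult n N` is continuous on the closed strip of half-width `κ`, holomorphic in every coordinate
slice, `2π`-periodic (hence side-matching), and bounded by `MF N`. [folklore] -/
theorem stripRegular_freeMult (n : ℕ) [NeZero n] {κ : ℝ} (hκ0 : 0 ≤ κ) (hκ : (n : ℝ) * κ ≤ rOf (d + 1))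
    (N : ℕ) : StripRegular (d := d) (fun q : Fin (d + 1) → ℂ => freeMult n N q) κ (MF N) := by
  have hdiffAt : ∀ p ∈ Strip (d + 1) κ, DifferentiableAt ℂ (fun q : Fin (d + 1) → ℂ => freeMult n N q) p :=
    fun p hp => differentiableAt_freeMult n hκ hp N
  refine ⟨?_, ?_, ?_, ?_⟩
  · exact fun p hp => (hdiffAt p hp).continuousAt.continuousWithinAt
  · intro i q hq z hz
    have hP : i.insertNth z (ofRealVec q) ∈ Strip (d + 1) κ :=
      insertNth_mem_Strip hκ0 i hq (openRect_subset_closedRect κ hz)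
    exact ((hdiffAt _ hP).comp z (differentiableAt_insertNth i _ z)).differentiableWithinAt
  · intro i q hq y hy
    exact sides_of_periodic (fun q : Fin (d + 1) → ℂ => freeMult n N q)
      (fun j p => by rw [← tr_def]; exact freeMult_tr n N p j) i q y
  · intro p hp
    exact norm_freeMult_le n hκ hp N

/-- the canonical half-width `r(d+1)/n` is admissible. [folklore] -/
theorem rOf_div_admissible (n : ℕ) [NeZero n] (d : ℕ) : (n : ℝ) * (rOf (d + 1) / n) ≤ rOf (d + 1) := by
  have hn : (n : ℝ) ≠ 0 := Nat.cast_ne_zero.mpr (NeZero.ne n)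
  rw [mul_div_assoc', mul_div_cancel_left₀ _ hn]

/-- the canonical half-width is positive. [folklore] -/
theorem rOf_div_pos (n : ℕ) [NeZero n] (d : ℕ) : 0 < rOf (d + 1) / n :=
  div_pos (rOf_pos _) (Nat.cast_pos.mpr (Nat.pos_of_ne_zero (NeZero.ne n)))

/-- **EXPONENTIAL DECAY OF THE FINE-LATTICE KERNEL OF THE FREE PART** (`B4ContourShift.latticeKernel_decay` by
name), in FINE-lattice integer coordinates `m ∈ ℤ^{d+1}`:
`‖K(m)‖ ≤ MF N · e^{−(r(d+1)/n)·|m|_∞} = MF N · e^{−r(d+1)·|ηm|_∞}` — unit-scale decay in COARSE units, with rate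
and constant INDEPENDENT of `n`. [folklore] -/
theorem latticeKernel_freeMult_decay (n : ℕ) [NeZero n] (N : ℕ) (m : Fin (d + 1) → ℤ) :
    ‖latticeKernel (fun q : Fin (d + 1) → ℂ => freeMult n N q) m‖ ≤
      MF N * Real.exp (-(rOf (d + 1) / n * supNorm m)) :=
  latticeKernel_decay (stripRegular_freeMult n (rOf_div_pos n d).le
    (rOf_div_admissible n d) N) (rOf_div_pos n d).le m

/-- **EXPONENTIAL DECAY OF THE TORUS KERNELS OF THE FREE PART**
(`B4TorusKernel.MultiPeriod.torusKernel_descend_decay_torusMetric` by name): for every period vector `P` (all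
`P_i ≥ 1`; for the fine torus of B5, `P_i = n·L_i`), `n ≥ 1`, `N`, `m`.  CAVEAT (v1.1): the constant
`periodConst (r(d+1)/n) d` is NOT uniform in `n` (it grows like `n^{d+1}`); `n`-uniformity holds for the `ℤ^{d+1}` kernel
(`latticeKernel_freeMult_decay`) only; an `n`-uniform torus bound needs the image sum in coarse units (period `L_i` after
`x = ηm`) — HONEST SCOPE (v). [folklore] -/
theorem torusKernel_freeMult_decay (n : ℕ) [NeZero n] (N : ℕ) {P : Fin (d + 1) → ℕ} (hP : ∀ i, 1 ≤ P i)
    (m : Fin (d + 1) → ℤ) :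
    ‖torusKernel (descendC (fun q : Fin (d + 1) → ℂ => freeMult n N q)
        (stripRegular_freeMult n (rOf_div_pos n d).le (rOf_div_admissible n d) N)
        (rOf_div_pos n d).le) P m‖ ≤
      MF N * periodConst (rOf (d + 1) / n) d *
        Real.exp (-((rOf (d + 1) / n) / (d + 1) * torusSupNorm P m)) :=
  torusKernel_descend_decay_torusMetric _ (rOf_div_pos n d) hP m

end Regular

end Literature.MathematicalPhysics.QuantumFieldTheory.Balaban1983to89.B5G183FreeDecay
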